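import Summits.ResolutionOfSingularities.ResolutionOfSingularities.Theorems.WeightedInvariantIota3Eps
import Summits.ResolutionOfSingularities.ResolutionOfSingularities.Theorems.WeightedInvariantIotaOrderStratDimTwo
import Literature.AlgebraicGeometry.Resolution.NagataCriterion
import HarnessLib

/-!
# The permissibility letter `ε` (`Iota3.iotaEps`): «permissibility localises», (c7) for the pair `(ν, ε)`, and the
# (strat) CERTIFICATE at every position of Krull dimension ≤ 3
# (door `HypersurfaceCentreConstruction`, stmt-ResolutionOfSingularities-19897, route `WeightedInvariant`, rung P3)

[OURS · L1 W4.3 · cell `res-hironaka`, HUMAN RULING D-0089] Helper file `--supports stmt-ResolutionOfSingularities-19897`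
(res-type-078 g13; ORDER (o30) INPUT A §2/§4 «ε is a (strat)-CERTIFICATE», sequel (o32-ι-a′) to res-type-013's
`…Iota3Eps` (o32-ι-a)).  Replaces the role of NO printed item; NOT a statement of the manuscript under review
[claim: Hironaka2017, status: under-review].  AI work, weaker than expert review.  Def-free; pure commutative algebra over
the tree.

The objects are res-type-013's: `Iota3.IsPermissibleEquimultipleLocus R g` (∃ prime `P`, `R ⧸ P` regular, the top
`iotaOrd`-stratum `topStratum iotaOrd R g` of res-type-005 is `{𝔮 | P ≤ 𝔮}`), `Iota3.iotaEps` (0/1) and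
`Iota3.iotaOrdEps = iotaLex ω iotaOrd iotaEps`.  This file proves, for them:

* dimension ≤ 2: through res-type-013's bridge `isPermissibleEquimultipleLocus_iff_strat`, res-type-073's
  `strat_iotaOrd_of_ringKrullDim_le_two` (p509553) gives `isPermissibleEquimultipleLocus_of_ringKrullDim_le_two` and
  `iotaEps_eq_zero_of_ringKrullDim_le_two`; units of a regular local ring have `ε = 0` (`iotaEps_of_isUnit`, junk value
  recorded so that the stratum-relative clauses need no case split);
* **«PERMISSIBILITY LOCALISES»** `isPermissibleEquimultipleLocus_localization`: `ε = 0` at `S`, the order of `f` kept at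
  a prime `𝔭 ∋ f` ⇒ `ε = 0` at `S_𝔭` (witness `P S_𝔭`; primes of `S_𝔭` = primes of `S` inside `𝔭`, `(S_𝔭)_{𝔮'} ≅ S_𝔮`,
  `S_𝔭 ⧸ P S_𝔭 ≅ (S ⧸ P)_{𝔭/P}` regular by `isRegularLocalRing_localization_quotient_iff` (NagataCriterion) +
  `isRegularLocalRing_localization_atPrime`);
* hence **(c7) on the order stratum** `iotaEps_generizationMonotoneOn : IotaGenerizationMonotoneOn iotaOrd iotaEps` and,
  by res-type-073's transfer kit (p504861), **(c7) for the pair** `iotaOrdEps_generizationMonotone` — the first of the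
  «stratum-relative» clauses of ε listed as open in res-type-013's block, in fact elementary;
* **THE (strat) CERTIFICATE AT KRULL DIMENSION ≤ 3** `strat_iotaOrdEps_of_ringKrullDim_le_three`: `S` regular local,
  `dim S ≤ 3`, `0 ≠ f ∈ 𝔪` ⇒ ∃ prime `P ∋ f`, `S ⧸ P` regular, with `∀ 𝔭 ∋ f, (iotaOrdEps (S_𝔭) f = iotaOrdEps S f ↔
  P ≤ 𝔭)` — the (strat) conjunct of `CanonicalGameClause` for `(ν, ε)` (`ε = 0`: `P` = the permissible prime, kept along
  `V(P)` by localisation; `ε = 1`: `P = 𝔪`, because a prime `𝔭 ≠ 𝔪` keeping the pair has `dim S_𝔭 ≤ 2`, where `ε = 0`).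
  Every candidate `ι₃ = (ν; ε; σ)` inherits (strat) at dimension ≤ 3 from this certificate as soon as its later letters are
  read CYLINDER-WISE along the certificate's `V(P)` (plan-1's (o32-ι-c)); this file makes no claim about `σ`, (drop),
  (c8), (c10) or (c11).

## References

* res-type-013 `…Iota3Eps` ((o32-ι-a)); res-type-005 `…ContactCylinderDefs` (p524206); res-type-073 `…IotaLex`
  (p504861), `…IotaOrderStratDimTwo` (p509553); res-type-078 `…IotaOrderEquimultipleCentre` (p524107), `IOTA3-INPUT.md`
  v1.1; res-L1-w43-plan-1 ORDERS (o30)/(o32-ι) (OURS, AI planning).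
* H. Matsumura, *Commutative Ring Theory*, CUP 1986, §4–§5 (primes and height under localisation), Thm. 19.3
  (localisation of a regular ring). [Matsumura1987]
-/

noncomputable section

open IsLocalRing Literature.AlgebraicGeometry.Resolution

set_option linter.dupNamespace false -- mandated namespace of this single-conjunct summit

namespace Summit.ResolutionOfSingularities.ResolutionOfSingularities.Cruxes.HypersurfaceCentreConstruction.LocalEngine

namespace Iota3

open Summit.ResolutionOfSingularities.ResolutionOfSingularities.Theorems

/-! ## Unfolding the predicate at a non-unit of a local ring -/

section Unfold

variable {R : Type} [CommRing R]

/-- At positions of Krull dimension ≤ 2 the equal-order locus is always permissible (res-type-073's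
`strat_iotaOrd_of_ringKrullDim_le_two`, p509553). [OURS] -/
theorem isPermissibleEquimultipleLocus_of_ringKrullDim_le_two [IsRegularLocalRing R] (hdim : ringKrullDim R ≤ 2) {f : R}
    (hf0 : f ≠ 0) (hf : f ∈ maximalIdeal R) : IsPermissibleEquimultipleLocus R f :=
  (isPermissibleEquimultipleLocus_iff_strat R hf).mpr (IotaOrderStrat.strat_iotaOrd_of_ringKrullDim_le_two hdim hf0 hf)

/-- Hence `ε = 0` at every `0 ≠ f ∈ 𝔪` of a regular local ring of Krull dimension ≤ 2. [OURS] -/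
theorem iotaEps_eq_zero_of_ringKrullDim_le_two [IsRegularLocalRing R] (hdim : ringKrullDim R ≤ 2) {f : R} (hf0 : f ≠ 0)
    (hf : f ∈ maximalIdeal R) : iotaEps R f = 0 :=
  (iotaEps_eq_zero_iff R f).mpr (isPermissibleEquimultipleLocus_of_ringKrullDim_le_two hdim hf0 hf)

/-- A unit of a local ring has order `0`. [folklore] -/
theorem iotaOrd_of_isUnit [IsLocalRing R] {g : R} (hg : IsUnit g) : iotaOrd R g = 0 := by
  have h : iotaOrd R g = ((0 : ℕ) : Ordinal) := by
    rw [iotaOrd_eq_natCast_iff]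
    refine ⟨by simp, ?_⟩
    rw [zero_add, pow_one]
    exact fun hm => (mem_nonunits_iff.mp ((IsLocalRing.mem_maximalIdeal _).mp hm)) hg
  rw [h, Nat.cast_zero]

/-- In a local ring, order `0` means unit. [folklore] -/
theorem isUnit_of_iotaOrd_eq_zero [IsLocalRing R] {g : R} (h : iotaOrd R g = 0) : IsUnit g := by
  have h' := ((iotaOrd_eq_natCast_iff R g 0).mp (by exact_mod_cast h)).2
  rw [zero_add, pow_one] at h'
  by_contra hnu
  exact h' ((IsLocalRing.mem_maximalIdeal g).mpr (mem_nonunits_iff.mpr hnu))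

/-- A unit of a REGULAR local ring has `ε = 0` (its top stratum is everything = `V(⊥)`; junk value, recorded so that the
stratum-relative clauses need no case distinction). [OURS] -/
theorem iotaEps_of_isUnit [IsRegularLocalRing R] {g : R} (hg : IsUnit g) : iotaEps R g = 0 := by
  haveI := isDomain_of_isRegularLocalRing R
  rw [iotaEps_eq_zero_iff]
  refine ⟨⊥, inferInstance, IsRegularLocalRing.of_ringEquiv (RingEquiv.quotientBot R).symm, Set.ext fun 𝔮 => ?_⟩
  rw [ContactCylinder.mem_topStratum_iff, Set.mem_setOf_eq]
  simp only [bot_le, iff_true]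
  haveI : IsLocalRing (Localization.AtPrime 𝔮.asIdeal) := inferInstance
  rw [iotaOrd_of_isUnit hg, iotaOrd_of_isUnit (hg.map _)]

end Unfold

/-! ## Permissibility localises -/

section Localise

variable {S : Type} [CommRing S]

/-- `S_𝔭 ⧸ P S_𝔭` is regular when `S ⧸ P` is a regular local ring and `P ≤ 𝔭` (it is the localisation of `S ⧸ P` at
`𝔭 ⧸ P`). [cite: Matsumura1987, Thm. 19.3] -/
theorem isRegularLocalRing_localization_quotient_map (P 𝔭 : Ideal S) [𝔭.IsPrime] [IsRegularLocalRing (S ⧸ P)]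
    (hle : P ≤ 𝔭) :
    IsRegularLocalRing (Localization.AtPrime 𝔭 ⧸ P.map (algebraMap S (Localization.AtPrime 𝔭))) := by
  haveI : (𝔭.map (Ideal.Quotient.mk P)).IsPrime :=
    Ideal.map_isPrime_of_surjective Ideal.Quotient.mk_surjective (by rwa [Ideal.mk_ker])
  exact (isRegularLocalRing_localization_quotient_iff P 𝔭 hle).mpr
    (isRegularLocalRing_localization_atPrime (S ⧸ P) (𝔭.map (Ideal.Quotient.mk P)))

/-- The order of `f` at a prime `𝔮'` of `S_𝔭` is its order at the contraction `𝔮 = 𝔮' ∩ S` (`(S_𝔭)_{𝔮'} ≅ S_𝔮`).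
[folklore] -/
theorem iotaOrd_localization_localization (𝔭 : Ideal S) [𝔭.IsPrime] (𝔮' : Ideal (Localization.AtPrime 𝔭))
    [𝔮'.IsPrime] (f : S) :
    iotaOrd (Localization.AtPrime 𝔮')
        (algebraMap (Localization.AtPrime 𝔭) (Localization.AtPrime 𝔮') (algebraMap S (Localization.AtPrime 𝔭) f)) =
      iotaOrd (Localization.AtPrime (𝔮'.comap (algebraMap S (Localization.AtPrime 𝔭))))
        (algebraMap S (Localization.AtPrime (𝔮'.comap (algebraMap S (Localization.AtPrime 𝔭)))) f) := by
  let 𝔮 := 𝔮'.comap (algebraMap S (Localization.AtPrime 𝔭))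
  let e : Localization.AtPrime 𝔮 ≃ₐ[S] Localization.AtPrime 𝔮' :=
    IsLocalization.localizationLocalizationAtPrimeIsoLocalization 𝔭.primeCompl 𝔮'
  have h1 : algebraMap (Localization.AtPrime 𝔭) (Localization.AtPrime 𝔮') (algebraMap S (Localization.AtPrime 𝔭) f) =
      algebraMap S (Localization.AtPrime 𝔮') f := (IsScalarTower.algebraMap_apply S _ _ f).symm
  have h2 : e (algebraMap S (Localization.AtPrime 𝔮) f) = algebraMap S (Localization.AtPrime 𝔮') f := e.commutes f
  rw [h1, ← h2]
  exact iotaOrd_isoInvariant _ _ e.toRingEquiv _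

/-- **Permissibility localises.**  If `ε = 0` at `(S, f)` with `f ∈ 𝔪` and the order of `f` is kept at a prime `𝔭 ∋ f`,
then `ε = 0` at `(S_𝔭, f)`: the top stratum of `S_𝔭` is `V(P S_𝔭)` for the permissible prime `P` of `S`.
[OURS · L1 W4.3, kernel] -/
theorem isPermissibleEquimultipleLocus_localization [IsLocalRing S] {f : S} (hf : f ∈ maximalIdeal S)
    (h : IsPermissibleEquimultipleLocus S f) (𝔭 : Ideal S) [𝔭.IsPrime] (hf𝔭 : f ∈ 𝔭)
    (heq : iotaOrd (Localization.AtPrime 𝔭) (algebraMap S (Localization.AtPrime 𝔭) f) = iotaOrd S f) :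
    IsPermissibleEquimultipleLocus (Localization.AtPrime 𝔭) (algebraMap S (Localization.AtPrime 𝔭) f) := by
  obtain ⟨P, hP, hreg, hfP, hiff⟩ := (isPermissibleEquimultipleLocus_iff_strat S hf).mp h
  have hP𝔭 : P ≤ 𝔭 := (hiff 𝔭 hf𝔭).mp heq
  set Sp := Localization.AtPrime 𝔭
  have hf' : algebraMap S Sp f ∈ maximalIdeal Sp := by
    rw [← Localization.AtPrime.map_eq_maximalIdeal]
    exact Ideal.mem_map_of_mem _ hf𝔭
  have hdisj : Disjoint (𝔭.primeCompl : Set S) (P : Set S) :=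
    Set.disjoint_left.mpr fun s hs hsP => hs (hP𝔭 hsP)
  haveI hP' : (P.map (algebraMap S Sp)).IsPrime := IsLocalization.isPrime_of_isPrime_disjoint 𝔭.primeCompl Sp P hP hdisj
  refine (isPermissibleEquimultipleLocus_iff_strat Sp hf').mpr ⟨P.map (algebraMap S Sp), hP',
    isRegularLocalRing_localization_quotient_map P 𝔭 hP𝔭, Ideal.mem_map_of_mem _ hfP, fun 𝔮' _ hf𝔮' => ?_⟩
  let 𝔮 := 𝔮'.comap (algebraMap S Sp)
  have hf𝔮 : f ∈ 𝔮 := Ideal.mem_comap.mpr hf𝔮'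
  rw [iotaOrd_localization_localization 𝔭 𝔮' f, heq, hiff 𝔮 hf𝔮]
  constructor
  · intro hle
    exact (Ideal.map_mono hle).trans Ideal.map_comap_le
  · intro hle
    exact Ideal.le_comap_map.trans (Ideal.comap_mono hle)

end Localise

/-! ## (c7) on the order stratum, and (c7) for the pair -/

/-- `ε ≤ 1` everywhere. [OURS] -/
theorem iotaEps_le_one (R : Type) [CommRing R] (g : R) : iotaEps R g ≤ 1 := by
  by_cases h : IsPermissibleEquimultipleLocus R g
  · rw [(iotaEps_eq_zero_iff R g).mpr h]; exact zero_le_one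
  · rw [(iotaEps_eq_one_iff R g).mpr h]

/-- **(c7) for `ε` on the order stratum**: at a prime `𝔭` of a regular local ring where the order of `f` is kept, `ε`
does not increase (`ε = 0` localises at non-units; units and their generisations have `ε = 0`; `ε ≤ 1` otherwise).
[OURS · L1 W4.3, kernel] -/
theorem iotaEps_generizationMonotoneOn : IotaGenerizationMonotoneOn iotaOrd iotaEps := by
  intro S _ _ 𝔭 _ f heq
  haveI : IsRegularLocalRing (Localization.AtPrime 𝔭) := isRegularLocalRing_localization_atPrime S 𝔭
  by_cases hf𝔭 : f ∈ 𝔭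
  · have hf : f ∈ maximalIdeal S := IsLocalRing.le_maximalIdeal (Ideal.IsPrime.ne_top ‹_›) hf𝔭
    by_cases hperm : IsPermissibleEquimultipleLocus S f
    · rw [(iotaEps_eq_zero_iff _ _).mpr (isPermissibleEquimultipleLocus_localization hf hperm 𝔭 hf𝔭 heq)]
      exact bot_le
    · rw [(iotaEps_eq_one_iff S f).mpr hperm]
      exact iotaEps_le_one _ _
  · -- `f ∉ 𝔭`: `f` is a unit at `𝔭`, so its order there is `0`; the order being kept, `f` is a unit of `S`
    have hu : IsUnit (algebraMap S (Localization.AtPrime 𝔭) f) :=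
      IsLocalization.map_units (Localization.AtPrime 𝔭) (⟨f, hf𝔭⟩ : 𝔭.primeCompl)
    have hfu : IsUnit f := isUnit_of_iotaOrd_eq_zero (by rw [← heq, iotaOrd_of_isUnit hu])
    rw [iotaEps_of_isUnit hu, iotaEps_of_isUnit hfu]

/-- **(c7) for the pair `(ν, ε)`** on regular local rings (transfer kit `iotaLex_iotaOrd_generizationMonotone`, p504861).
[OURS · L1 W4.3, kernel] -/
theorem iotaOrdEps_generizationMonotone : IotaGenerizationMonotone iotaOrdEps :=
  iotaLex_iotaOrd_generizationMonotone iotaEps_boundedBy_omega0 iotaEps_generizationMonotoneOn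

/-! ## The (strat) certificate at positions of Krull dimension ≤ 3 -/

section Strat

variable {S : Type} [CommRing S]

/-- At the closed point nothing changes for the pair: `iotaOrdEps (S_𝔪) f = iotaOrdEps S f` (`S ≃ S_𝔪`, (c6)). [OURS] -/
theorem iotaOrdEps_localization_maximalIdeal_eq [IsLocalRing S] (f : S) :
    iotaOrdEps (Localization.AtPrime (maximalIdeal S)) (algebraMap S (Localization.AtPrime (maximalIdeal S)) f) =
      iotaOrdEps S f := by
  have hunits : (maximalIdeal S).primeCompl ≤ IsUnit.submonoid S := by
    intro x hx
    rw [IsUnit.mem_submonoid_iff]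
    by_contra hnu
    exact hx ((IsLocalRing.mem_maximalIdeal x).mpr (mem_nonunits_iff.mpr hnu))
  let e : S ≃ₐ[S] Localization.AtPrime (maximalIdeal S) :=
    IsLocalization.atUnits S (maximalIdeal S).primeCompl hunits
  have he : e f = algebraMap S (Localization.AtPrime (maximalIdeal S)) f := by
    simpa using e.commutes f
  rw [← he]
  exact iotaOrdEps_isoInvariant S (Localization.AtPrime (maximalIdeal S)) e.toRingEquiv f

/-- A prime strictly below the maximal ideal of a Noetherian local ring of Krull dimension ≤ 3 has a localisation of
Krull dimension ≤ 2. [cite: Matsumura1987, §5] -/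
theorem ringKrullDim_localization_le_two_of_ne [IsLocalRing S] [IsNoetherianRing S] (hdim : ringKrullDim S ≤ 3)
    (𝔭 : Ideal S) [𝔭.IsPrime] (h𝔭 : 𝔭 ≠ maximalIdeal S) : ringKrullDim (Localization.AtPrime 𝔭) ≤ 2 := by
  have hlt : 𝔭 < maximalIdeal S := lt_of_le_of_ne (IsLocalRing.le_maximalIdeal (Ideal.IsPrime.ne_top ‹_›)) h𝔭
  have h1 : 𝔭.height < (maximalIdeal S).height := Ideal.height_strict_mono_of_isPrime_of_isPrime hlt
  have h3 : ((maximalIdeal S).height : WithBot ℕ∞) ≤ 3 := by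
    rw [IsLocalRing.maximalIdeal_height_eq_ringKrullDim]
    exact hdim
  have h3' : (maximalIdeal S).height ≤ 3 := by
    rw [← WithBot.coe_le_coe, WithBot.coe_ofNat]
    exact h3
  have hlt3 : 𝔭.height < 3 := lt_of_lt_of_le h1 h3'
  obtain ⟨k, hk⟩ := ENat.ne_top_iff_exists.mp (ne_top_of_lt hlt3)
  have h2 : 𝔭.height ≤ 2 := by
    rw [← hk] at hlt3 ⊢
    have hk3 : k < 3 := by exact_mod_cast hlt3
    exact_mod_cast (show k ≤ 2 by omega)
  rw [IsLocalization.AtPrime.ringKrullDim_eq_height 𝔭 (Localization.AtPrime 𝔭), ← WithBot.coe_ofNat,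
    WithBot.coe_le_coe]
  exact h2

/-- **THE (strat) CERTIFICATE FOR `(ν, ε)` AT KRULL DIMENSION ≤ 3.**  Let `S` be a regular local ring with
`ringKrullDim S ≤ 3` and `0 ≠ f ∈ 𝔪`.  Then there is a prime `P ∋ f` with `S ⧸ P` regular such that for every prime
`𝔭 ∋ f`: `iotaOrdEps (S_𝔭) f = iotaOrdEps S f ↔ P ≤ 𝔭` — the (strat) conjunct of `CanonicalGameClause` for the pair
`(iotaOrd, iotaEps)`.  (`ε = 0`: `P` = the permissible prime of the order function, kept along `V(P)` by
`isPermissibleEquimultipleLocus_localization`; `ε = 1`: `P = 𝔪`, since a prime `𝔭 ≠ 𝔪` keeping the pair has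
`dim S_𝔭 ≤ 2`, where `ε = 0`.) [OURS · L1 W4.3, kernel] -/
theorem strat_iotaOrdEps_of_ringKrullDim_le_three [IsRegularLocalRing S] (hdim : ringKrullDim S ≤ 3) {f : S}
    (hf0 : f ≠ 0) (hf : f ∈ maximalIdeal S) :
    ∃ P : Ideal S, P.IsPrime ∧ IsRegularLocalRing (S ⧸ P) ∧ f ∈ P ∧
      ∀ (𝔭 : Ideal S) [𝔭.IsPrime], f ∈ 𝔭 →
        (iotaOrdEps (Localization.AtPrime 𝔭) (algebraMap S (Localization.AtPrime 𝔭) f) = iotaOrdEps S f ↔ P ≤ 𝔭) := by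
  haveI := isDomain_of_isRegularLocalRing S
  by_cases hperm : IsPermissibleEquimultipleLocus S f
  · -- `ε = 0`: the permissible prime of the order function is the certificate
    obtain ⟨P, hP, hreg, hfP, hiff⟩ := (isPermissibleEquimultipleLocus_iff_strat S hf).mp hperm
    refine ⟨P, hP, hreg, hfP, fun 𝔭 _ hf𝔭 => ?_⟩
    rw [iotaOrdEps_eq_iff]
    constructor
    · rintro ⟨hord, -⟩
      exact (hiff 𝔭 hf𝔭).mp hord
    · intro hle
      have hord := (hiff 𝔭 hf𝔭).mpr hle
      refine ⟨hord, ?_⟩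
      rw [(iotaEps_eq_zero_iff _ _).mpr (isPermissibleEquimultipleLocus_localization hf hperm 𝔭 hf𝔭 hord),
        (iotaEps_eq_zero_iff S f).mpr hperm]
  · -- `ε = 1`: the closed point is the certificate
    refine ⟨maximalIdeal S, inferInstance, ?_, hf, fun 𝔭 _ hf𝔭 => ⟨fun heq => ?_, fun hle => ?_⟩⟩
    · have hF : IsField (S ⧸ maximalIdeal S) :=
        (Ideal.Quotient.maximal_ideal_iff_isField_quotient (maximalIdeal S)).mp inferInstance
      letI := hF.toField
      infer_instance
    · by_contra hle
      have h𝔭 : 𝔭 ≠ maximalIdeal S := fun h => hle (h ▸ le_rfl)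
      rw [iotaOrdEps_eq_iff] at heq
      obtain ⟨-, heps⟩ := heq
      haveI : IsRegularLocalRing (Localization.AtPrime 𝔭) := isRegularLocalRing_localization_atPrime S 𝔭
      have hdim' : ringKrullDim (Localization.AtPrime 𝔭) ≤ 2 := ringKrullDim_localization_le_two_of_ne hdim 𝔭 h𝔭
      have hf0' : algebraMap S (Localization.AtPrime 𝔭) f ≠ 0 := fun h =>
        hf0 ((IsLocalization.injective (Localization.AtPrime 𝔭) 𝔭.primeCompl_le_nonZeroDivisors).eq_iff.mp
          (h.trans (map_zero _).symm))
      have hf' : algebraMap S (Localization.AtPrime 𝔭) f ∈ maximalIdeal (Localization.AtPrime 𝔭) := by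
        rw [← Localization.AtPrime.map_eq_maximalIdeal]
        exact Ideal.mem_map_of_mem _ hf𝔭
      have h0 := iotaEps_eq_zero_of_ringKrullDim_le_two hdim' hf0' hf'
      have h1 : iotaEps S f = 1 := (iotaEps_eq_one_iff S f).mpr hperm
      rw [h0, h1] at heps
      exact zero_ne_one heps
    · have h𝔭 : maximalIdeal S = 𝔭 := (IsLocalRing.maximalIdeal.isMaximal S).eq_of_le Ideal.IsPrime.ne_top' hle
      subst h𝔭
      exact iotaOrdEps_localization_maximalIdeal_eq f

end Strat



end Iota3

end Summit.ResolutionOfSingularities.ResolutionOfSingularities.Cruxes.HypersurfaceCentreConstruction.LocalEngine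

end
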